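import Literature.Analysis.OperatorTheory.PathKernelDomination
import Literature.Analysis.OperatorTheory.PositiveKernelSpectralTraceTwo
import Literature.Analysis.OperatorTheory.CompactSelfAdjointEigenbasis
import Literature.Analysis.OperatorTheory.PositivityImprovingSpectralGap
import Literature.Analysis.OperatorTheory.JointEigenbasis
import Literature.Analysis.OperatorTheory.PositiveKernelSpectralTraceTwoSucc
import Summits.QuantumFields.YangMills.Theorems.PencilRigidityWeakCouplingHypercubicLimitStubKernelOpTranspose
import HarnessLib

/-!
# Reflected spectral sums (line `Sketch` of crux `PencilRigidity.WeakCouplingHypercubicLimit`, stmt-QuantumFields-16120)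

ABSTRACT transfer-matrix spectral data for a REFLECTED pair of slab insertions (the `B̂* … B̂` geometry of
Osterwalder–Seiler reflection positivity in trace form): for a strongly measurable symmetric kernel `0 < K ≤ C` of
positive type on a probability space with countably generated σ-algebra and ONE strongly measurable bounded bond kernel
`X_b` dominated by `C_B` times the `r+1`-step path weight of `K`, the eigen-data `(bᵢ, λᵢ, i₀)` of the transfer operator
and the bond operator `B̂` of `X_b` (`‖B̂‖ ≤ C_B λ_{i₀}^{r+1}`) satisfy, besides the vacuum trace formulas and the
growth-rate formula of `stub_spectralData`, for EVERY gap `a ≥ 0` and arc `b'`, the two-insertion formula with the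
TRANSPOSED kernel `X_bᵀ` at bond `0` and `X_b` at bond `a+2`:
`cyclic integral = Σ_{(i,j)} λⱼ^{a+1} λᵢ^{b'+2} ⟪bⱼ, B̂ bᵢ⟫²` — all terms NON-NEGATIVE — and the one-insertion formulas
`= Σ λᵢ^{k+2} ⟪bᵢ, B̂ bᵢ⟫` for every `k` (`reflectedSpectralSums`).  Ingredients: the toolkit of `stub_spectralData`
(`PositiveKernelTransferOperator`, `CompactSelfAdjointEigenbasis`, `PathKernelDomination`,
`PositiveKernelSpectralTrace{,Two}`), the gap-`(a+1)` trace formula `hasSum_integral_iterate_insert_two_succ` and the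
adjointness of the transposed kernel operator `stub_kernelOpTranspose`.

References: M. Reed, B. Simon, *Methods of Modern Mathematical Physics I* (1980), Thm. VI.16, VI.22–23; B. Simon,
*Trace Ideals* (2005), Ch. 3; K. Osterwalder, E. Seiler, Ann. Phys. 110 (1978) §§2–3. [folklore]
-/

noncomputable section

open scoped BigOperators Topology InnerProductSpace ENNReal
open MeasureTheory Filter

namespace Summit.QuantumFields.YangMills.Theorems.WeakCouplingHypercubicLimit.TraceNormColdPressure

open Literature.Analysis.OperatorTheory Function Set

/-! ### The reflected spectral sums -/

/-- **Reflected spectral sums.**  For a strongly measurable symmetric kernel `0 < K ≤ C` of positive type on a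
probability space with countably generated σ-algebra and a strongly measurable bounded bond kernel `X_b` dominated by
`C_B` times the `r+1`-step path weight of `K`: a countable Hilbert basis of eigenvectors of the transfer operator with
eigenvalues `0 ≤ λᵢ ≤ λ_{i₀}`, `0 < λ_{i₀}`, `Σ λᵢ² < ∞`, the bond operator `B̂` with `‖B̂‖ ≤ C_B λ_{i₀}^{r+1}`, the
growth-rate formula, the vacuum trace formulas, and — for every gap `a` and arc `b'` — the two-insertion formula for the
cycle "`X_bᵀ`, `a+1` bonds `K`, `X_b`, `b'+2` bonds `K`" as the NON-NEGATIVE double sum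
`Σ_{(i,j)} λⱼ^{a+1} λᵢ^{b'+2} ⟪bⱼ, B̂ bᵢ⟫²`, and the one-insertion formulas `Σ λᵢ^{k+2} ⟪bᵢ, B̂ bᵢ⟫`. [folklore] -/
theorem reflectedSpectralSums :
    ∀ (X : Type) [MeasurableSpace X] [MeasurableSpace.CountablyGenerated X] (μ : Measure X) [IsProbabilityMeasure μ]
      (K : X → X → ℝ) (C : ℝ), StronglyMeasurable (Function.uncurry K) → (∀ x y, K x y = K y x) →
      (∀ x y, 0 < K x y ∧ K x y ≤ C) →
      (∀ f : X → ℝ, Measurable f → (∀ x, |f x| ≤ 1) → 0 ≤ ∫ x, ∫ y, f x * K x y * f y ∂μ ∂μ) →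
    ∀ (r : ℕ) (Xb : X → X → ℝ) (CB CX : ℝ), StronglyMeasurable (Function.uncurry Xb) →
      (∀ u u', |Xb u u'| ≤ CX) →
      (∀ u u' : X, |Xb u u'| ≤ CB * (∫ v : Fin r → X, ∏ i : Fin (r + 1), K ((Fin.cons u (Fin.snoc v u') : Fin (r + 2) → X) (Fin.castSucc i)) ((Fin.cons u (Fin.snoc v u') : Fin (r + 2) → X) (Fin.succ i)) ∂(Measure.pi fun _ => μ))) →
    ∃ (ι : Type) (_ : Countable ι) (b : HilbertBasis ι ℝ (Lp ℝ 2 μ)) (lam : ι → ℝ) (i₀ : ι)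
      (Bop : Lp ℝ 2 μ →L[ℝ] Lp ℝ 2 μ),
      (∀ i, 0 ≤ lam i ∧ lam i ≤ lam i₀) ∧ 0 < lam i₀ ∧ Summable (fun i => lam i ^ 2) ∧
      ‖Bop‖ ≤ CB * lam i₀ ^ (r + 1) ∧
      limsup (fun m : ℕ => (∫ V : Fin (m + 1) → X, ∏ t, K (V t) (V (t + 1)) ∂(Measure.pi fun _ => μ)) ^ (((m : ℝ) + 1)⁻¹))
        atTop = lam i₀ ∧
      (∀ m : ℕ, HasSum (fun i => lam i ^ (m + 2))
        (∫ V : Fin (m + 2) → X, ∏ t, K (V t) (V (t + 1)) ∂(Measure.pi fun _ => μ))) ∧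
      (∀ a b' : ℕ, HasSum (fun pr : ι × ι => lam pr.2 ^ (a + 1) * lam pr.1 ^ (b' + 2) *
          inner ℝ (b pr.2) (Bop (b pr.1)) ^ 2)
        (∫ V : Fin (1 + (a + 1 + (b' + 1 + 1)) + 1) → X, ∏ t : Fin (1 + (a + 1 + (b' + 1 + 1)) + 1),
          (fun s : ℕ => if s = 0 then (fun u u' : X => Xb u' u) else if s = a + 1 + 1 then Xb else fun x x' : X => K x x')
            (t : ℕ) (V t) (V (t + 1)) ∂(Measure.pi fun _ => μ))) ∧
      (∀ k : ℕ, HasSum (fun i => lam i ^ (k + 2) * inner ℝ (b i) (Bop (b i)))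
        (∫ V : Fin (1 + (k + 1) + 1) → X, Xb (V 0) (V 1) *
          ∏ t : Fin (1 + (k + 1)), K (V t.succ) (V (t.succ + 1)) ∂(Measure.pi fun _ => μ))) := by
  intro X _ _ μ _ K C hK hsymm hpos hpt r Xb CB CX hXb hbd hdomB
  -- bounds in norm form, a point of `X`
  have hC : ∀ x y, ‖K x y‖ ≤ C := fun x y => by
    rw [Real.norm_of_nonneg (hpos x y).1.le]; exact (hpos x y).2
  have hpos' : ∀ x y, 0 < K x y := fun x y => (hpos x y).1
  have hCXb : ∀ x y, ‖Xb x y‖ ≤ CX := fun x y => by rw [Real.norm_eq_abs]; exact hbd x y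
  -- the transposed kernel
  have hXa : StronglyMeasurable (Function.uncurry fun u u' : X => Xb u' u) := by
    have h := hXb.comp_measurable (measurable_swap : Measurable (Prod.swap : X × X → X × X))
    exact h
  have hCXa : ∀ x y, ‖(fun u u' : X => Xb u' u) x y‖ ≤ CX := fun x y => hCXb y x
  obtain ⟨x₀, -⟩ := nonempty_of_measure_ne_zero (μ := μ) (s := univ) (by rw [measure_univ]; exact one_ne_zero)
  have hC0 : 0 ≤ C := (norm_nonneg _).trans (hC x₀ x₀)
  -- the transfer operator and an eigenbasis
  obtain ⟨A, hA⟩ := exists_kernelOp (μ := μ) hK hC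
  have hsa := isSelfAdjoint_kernelOp hK hC hsymm hA
  have hcpt := isCompactOperator_kernelOp hC hC0 hA
  have himp := isPositivityImproving_kernelOp hK hC hpos' hA
  have hA0 := kernelOp_ne_zero hK hC hpos' (IsProbabilityMeasure.ne_zero μ) hA
  obtain ⟨s, b, lam, hbs, hb0⟩ := exists_hilbertBasis_eigenvectors_of_isSelfAdjoint hcpt hsa
  have hb : ∀ i, A (b i) = lam i • b i := fun i => by simpa using hb0 i
  haveI : Fact ((2 : ℝ≥0∞) ≠ ⊤) := ⟨ENNReal.ofNat_ne_top⟩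
  have hon : Orthonormal ℝ ((↑) : s → Lp ℝ 2 μ) := hbs ▸ b.orthonormal
  have hcnt : Countable s := (hon.countable_of_separableSpace (𝕜 := ℝ)).to_subtype
  haveI : Countable s := hcnt
  -- non-negative eigenvalues (positive type), the top eigenvalue `λ_{i₀} = ‖A‖ > 0`
  have hlam0 : ∀ i, 0 ≤ lam i := fun i => by
    rw [lam_eq_inner hb i]; exact inner_kernelOp_self_nonneg hA hpt _
  obtain ⟨ψ, hψ0, hψ⟩ := himp.exists_top_eigenvector_of_isCompactOperator hsa hcpt hA0
  obtain ⟨i₀, hi₀⟩ := exists_index_eq_norm b hsa hb hψ0 hψ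
  have hle : ∀ i, lam i ≤ lam i₀ := fun i => (le_abs_self _).trans ((abs_lam_le_norm hb i).trans hi₀.ge)
  have hL0 : 0 < lam i₀ := by rw [hi₀]; exact norm_pos_iff.2 hA0
  have hS := hasSum_lam_sq hK hC hA hb
  -- the bond operators; kernel domination for `B̂`; adjointness `⟪bᵢ, Â bⱼ⟫ = ⟪bⱼ, B̂ bᵢ⟫`
  obtain ⟨Aop, hAop⟩ := exists_kernelOp (μ := μ) hXa hCXa
  obtain ⟨Bop, hBop⟩ := exists_kernelOp (μ := μ) hXb hCXb
  have hP0 := pathKernel_pos (μ := μ) hK.measurable hC hpos' r x₀ x₀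
  have hCB : 0 ≤ CB := nonneg_of_mul_nonneg_left ((abs_nonneg _).trans (hdomB x₀ x₀)) hP0
  have hnB : ‖Bop‖ ≤ CB * lam i₀ ^ (r + 1) := by
    rw [hi₀]; exact norm_kernelOp_le_of_abs_le_pathKernel hK hC hA hBop r hCB hdomB
  have hadj : ∀ i j, inner ℝ (b i) (Aop (b j)) = inner ℝ (b j) (Bop (b i)) := fun i j => by
    rw [stub_kernelOpTranspose X μ (fun u u' : X => Xb u' u) Xb CX hXa hXb hCXa hCXb (fun _ _ => rfl) Aop Bop hAop
      hBop (b i) (b j), real_inner_comm]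
  -- the trace formulas
  have h6 : ∀ m : ℕ, HasSum (fun i => lam i ^ (m + 2))
      (∫ V : Fin (m + 2) → X, ∏ t, K (V t) (V (t + 1)) ∂(Measure.pi fun _ => μ)) := fun m =>
    hasSum_pow_integral_cyclic hK hC hsymm hA hb hlam0 m
  have hlimsup := limsup_rpow_eq_of_hasSum_pow hlam0 hle hL0 hS.summable
    (Z := fun m => ∫ V : Fin (m + 1) → X, ∏ t, K (V t) (V (t + 1)) ∂(Measure.pi fun _ => μ)) fun n => h6 n
  have hmXa : ∀ x y, ‖(fun u u' : X => Xb u' u) x y‖ ≤ max CX C := fun x y => (hCXa x y).trans (le_max_left _ _)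
  have hmXb : ∀ x y, ‖Xb x y‖ ≤ max CX C := fun x y => (hCXb x y).trans (le_max_left _ _)
  have hmK : ∀ x y, ‖K x y‖ ≤ max CX C := fun x y => (hC x y).trans (le_max_right _ _)
  have h7 : ∀ a b' : ℕ, HasSum (fun pr : s × s => lam pr.2 ^ (a + 1) * lam pr.1 ^ (b' + 2) *
        inner ℝ (b pr.2) (Bop (b pr.1)) ^ 2)
      (∫ V : Fin (1 + (a + 1 + (b' + 1 + 1)) + 1) → X, ∏ t : Fin (1 + (a + 1 + (b' + 1 + 1)) + 1),
        (fun s : ℕ => if s = 0 then (fun u u' : X => Xb u' u) else if s = a + 1 + 1 then Xb else fun x x' : X => K x x')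
          (t : ℕ) (V t) (V (t + 1)) ∂(Measure.pi fun _ => μ)) := by
    intro a b'
    have hc2 := integral_cyclic_insert_two (ρ := μ) (X := fun u u' : X => Xb u' u) (X' := Xb) (K := fun x x' => K x x')
      hXa.measurable hXb.measurable hK.measurable hmXa hmXb hmK (a + 1) (b' + 1)
    have h := hasSum_integral_iterate_insert_two_succ hK hC hsymm hA hb hXa hCXa hAop hXb hCXb hBop a b'
    rw [← hc2] at h
    refine (h.congr_fun fun pr => ?_ )
    rw [hadj pr.1 pr.2, sq]
    ring
  have h8 : ∀ k : ℕ, HasSum (fun i => lam i ^ (k + 2) * inner ℝ (b i) (Bop (b i)))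
      (∫ V : Fin (1 + (k + 1) + 1) → X, Xb (V 0) (V 1) *
        ∏ t : Fin (1 + (k + 1)), K (V t.succ) (V (t.succ + 1)) ∂(Measure.pi fun _ => μ)) := by
    intro k
    have hc1 := integral_cyclic_insert_one (ρ := μ) (X := Xb) (K := K) hXb.measurable hK.measurable hmXb hmK (k + 1)
    have h9 := hasSum_integral_iterate_insert_one hK hC hsymm hA hb hXb hCXb hBop k
    rw [← hc1] at h9
    exact h9
  exact ⟨s, hcnt, b, lam, i₀, Bop, fun i => ⟨hlam0 i, hle i⟩, hL0, hS.summable, hnB, hlimsup, h6, h7, h8⟩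

end Summit.QuantumFields.YangMills.Theorems.WeakCouplingHypercubicLimit.TraceNormColdPressure

end
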